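import Summits.HodgeConjecture.HodgeConjecture.Theorems.K2E1BLConstantTermProjectionU2      -- ★ p858855 FILE A (imports ★ P2a A p858804, ★ leaf p858761): §1 toolkit, `cnstN`, `restrHN`
import Summits.HodgeConjecture.HodgeConjecture.Theorems.K2E1TruncatedCuspCompactU2          -- ★ p858828 K2 (K2E1-p11): `measurableSet_lt_borelQuotHeight` (reused, dedup)
import Mathlib.MeasureTheory.Function.ConditionalExpectation.Indicator                       -- Mathlib `condExp_restrict_ae_eq_restrict`
import HarnessLib

/-!
# The constant-term projection commutes with the restriction maps:
# `cnst_k ∘ restr_{c,c₀} = restr_{c,c₀} ∘ cnst_k` on `𝓗_k(Z_c)`, `Z = B(F)∖G(𝔸_F)` — Bernstein–Lapid §4 Claim 4 («BL-P2b-B», `restr` half)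

(Bernstein–Lapid, arXiv:1911.02342 = J. AMS 37 (2024), §4 Claim 4 p. 10: the constant-term projection `cnst_N` of `𝓗_N(Z_c)` is
compatible with the restriction maps `𝓗_N(Z_c) → 𝓗_N(Z_{c₀})`, `c ≤ c₀`; Mœglin–Waldspurger (1995), I.2.6, I.2.13.)

Topic `NumberTheory/Automorphic`; crux H413, cell `pub/hodgecm-mathlib`, campaign «EIS-R7-BL-SPH-2», deal «BL-P2b-B» (dealer K2E1-plan (g5)
2026-09-04T09:11:34Z: «only the cheap `restrHN` half; the `deltaShift` commutation PARKED»), leaf of record ★ `K2E1BLBorelSpacesU2Defs`,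
FILE A ★ `K2E1BLConstantTermProjectionU2`. THEOREMS ONLY over accepted tree modules (no definition, no named fact, no instance, no notation,
no `sorry`). GENERIC in Mok's datum `quasiSplit F E c N` (any rank `N`; the N = 3 clone reuses this file verbatim).

THE OBJECTS (★ leaf). `μw_c := weightedTruncMeasure k c μZ = (μZ|_{c < HZ})·HZ^{−2k}`, `𝓗_k(Z_c) = HN k c μZ = L²(μw_c)`,
`restr_{c,c₀} = restrHN k (h : c ≤ c₀) μZ : 𝓗_k(Z_c) →L 𝓗_k(Z_{c₀})` (class of the same function), `cnst_k = cnstN k c μZ` = the orthogonal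
projection onto the classes measurable for the `N(𝔸)`-invariant σ-algebra `mN = invariantSigma` (Mathlib `condExpL2`).

THE ARGUMENT. (1) `μw_{c₀} = μw_c|_{c₀ < HZ}` (`restrict_withDensity`, `restrict_restrict`; §1). (2) The height `HZ` is left-`N(𝔸)B(F)`-invariant
(★ `borelHeight_unipotent_mul`, ★ `borelHeight_rational_borel_mul`), hence descends continuously to the base `N(𝔸)B(F)∖G(𝔸)` and is `mN`-measurable;
so the truncation set `{c₀ < HZ}` is an `mN`-set (§1). (3) Mathlib's `condExp_restrict_ae_eq_restrict`: conditioning on `mN` commutes with restriction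
to an `mN`-set; with the generic unfolding `⇑(cnst_k f) =ᵐ μw[⇑f | mN]` (§2) both sides of the commutation are a.e. equal to `μw_c[⇑f | mN]` on `Z_{c₀}` (§3).

* §0 `zFun_comp_toBorelQuotient`, **`toHN_coe_comp_toBorelQuotient`** (`toHN (⇑f ∘ π) = f`: FILE A's (i)∕(iii) apply to ANY class — dealer 09:07:50Z one-liner).
* §1 **`weightedTruncMeasure_eq_restrict`**, `borelHeight_adelicUnipBorel_mul`,
  **`measurable_invariantSigma_borelQuotHeight`**, **`measurableSet_invariantSigma_setOf_lt`**.
* §2 **`coeFn_cnstN_ae_eq_condExp`** (generic unfolding), `condExp_weightedTruncMeasure_ae_eq_condExp`.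
* §3 **`cnstN_restrHN`**, **`cnstN_comp_restrHN`**, `cnstN_restrHN_of_cnstN_eq_self`, `restrHN_mem_lpMeas`, `restrHN_mem_HNcusp`, `map_restrHN_HNcusp_le`.
NOT HERE (parked): `cnst_k ∘ δ_{c,c₀}(h) = δ_{c,c₀}(h) ∘ cnst_k`.
HONEST LABEL: HC_CM is proved only modulo the 7 printed citations (2 remaining named inputs: hLiu418 = `stmt-HodgeConjecture-24832`,
h413 = `stmt-HodgeConjecture-24833`) until rung 0 closes; count-neutral helper, closes no socket.

## References
* J. Bernstein, E. Lapid, *On the meromorphic continuation of Eisenstein series*, arXiv:1911.02342, J. AMS 37 (2024): §4 Claim 4 (p. 10) [BernsteinLapid2019].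
* C. Mœglin, J.-L. Waldspurger, *Spectral Decomposition and Eisenstein Series*, CUP (1995): I.2.6, I.2.13 [MoeglinWaldspurger1995].
-/

set_option autoImplicit false
set_option linter.dupNamespace false

noncomputable section

open MeasureTheory Measure NumberField IsDedekindDomain Set Filter Topology
open scoped ENNReal NNReal
open Literature.NumberTheory.Automorphic Literature.NumberTheory.Automorphic.UnitaryGroup AdelicGroupData
open Summit.HodgeConjecture.HodgeConjecture.Cruxes.H413.K2E1BLBorelSpacesU2Defs
open Summit.HodgeConjecture.HodgeConjecture.Cruxes.H413.K2E1BLSpacesU2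
open Summit.HodgeConjecture.HodgeConjecture.Cruxes.H413.K2E1BLConstantTermProjectionU2

namespace Summit.HodgeConjecture.HodgeConjecture.Cruxes.H413.K2E1BLConstantTermProjectionRestrictU2

variable {F E : Type} [Field F] [NumberField F] [Field E] [NumberField E] [Algebra F E] {c : E ≃ₐ[F] E} {N : ℕ}

/-! ## §0 Every class of `𝓗_k(Z_c)` is a `toHN` (FILE A's hypotheses-on-`φ` theorems apply to general classes) -/

/-- `zFun (f ∘ π) = f` for ANY function `f` on `Z` (`π (out z) = z`). [cite: BernsteinLapid2019, §4 p. 10] -/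
theorem zFun_comp_toBorelQuotient (f : borelQuotient F E c N → ℂ) :
    zFun F E c N (f ∘ toBorelQuotient F E c N) = f :=
  funext fun z => congrArg f
    (Quotient.out_eq (z : Quotient (MulAction.orbitRel (ratBorelSubgroup F E c N) (quasiSplit F E c N).Adelic)))

/-- The lift `⇑f ∘ π` is left-`B(F)`-invariant (indeed constant on `B(F)`-classes). [cite: BernsteinLapid2019, §4 p. 10] -/
theorem coe_comp_toBorelQuotient_mul {X : Type*} (f : borelQuotient F E c N → X) :
    ∀ b ∈ ratBorelSubgroup F E c N, ∀ g, (f ∘ toBorelQuotient F E c N) (b * g) = (f ∘ toBorelQuotient F E c N) g :=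
  fun b hb g => congrArg f ((toBorelQuotient_eq_iff F E c N (b * g) g).2 ⟨⟨b, hb⟩, rfl⟩)

variable [NeZero N]

/-- The lift `⇑f ∘ π` of a class `f ∈ 𝓗_k(Z_c)` is square integrable (it IS `⇑f` on `Z`). [cite: BernsteinLapid2019, §4 p. 10] -/
theorem memLp_zFun_coe_comp_toBorelQuotient (k : ℕ) (c₁ : ℝ≥0) (μZ : Measure (borelQuotient F E c N)) (f : HN F E c N k c₁ μZ) :
    MemLp (zFun F E c N ((f : borelQuotient F E c N → ℂ) ∘ toBorelQuotient F E c N)) 2 (weightedTruncMeasure F E c N k c₁ μZ) := by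
  rw [zFun_comp_toBorelQuotient]
  exact Lp.memLp f

/-- **`toHN (⇑f ∘ π) = f`**: every class of `𝓗_k(Z_c)` is the `toHN` of its own lift to `G(𝔸)` — so FILE A's identification (i) and kernel reading (iii),
stated for `toHN φ`, apply to ANY class `f` (with `φ := ⇑f ∘ π`, left-`B(F)`-invariant by construction). [cite: BernsteinLapid2019, §4 Claim 4 p. 10] -/
theorem toHN_coe_comp_toBorelQuotient (k : ℕ) (c₁ : ℝ≥0) (μZ : Measure (borelQuotient F E c N)) (f : HN F E c N k c₁ μZ)
    (hf : MemLp (zFun F E c N ((f : borelQuotient F E c N → ℂ) ∘ toBorelQuotient F E c N)) 2 (weightedTruncMeasure F E c N k c₁ μZ)) :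
    toHN F E c N k c₁ μZ ((f : borelQuotient F E c N → ℂ) ∘ toBorelQuotient F E c N) hf = f := by
  rw [toHN]
  exact (MemLp.toLp_congr hf (Lp.memLp f) (by rw [zFun_comp_toBorelQuotient])).trans (Lp.toLp_coeFn f (Lp.memLp f))

/-! ## §1 The truncated measures are restrictions of each other along the `mN`-set `{c₀ < HZ}` -/

/-- **`μw_{c₀} = μw_c |_{Z_{c₀}}`** for `c ≤ c₀`: the weighted truncated measure at the higher level is the restriction of the lower one to
`{c₀ < HZ}` (a Borel set, ★ `measurableSet_lt_borelQuotHeight`; Mathlib `restrict_withDensity`, `restrict_restrict`). [cite: BernsteinLapid2019, §4 Claim 4 p. 10]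
[cite: MoeglinWaldspurger1995, I.2.13] -/
theorem weightedTruncMeasure_eq_restrict (k : ℕ) {c₁ c₀ : ℝ≥0} (h : c₁ ≤ c₀) (μZ : Measure (borelQuotient F E c N)) :
    weightedTruncMeasure F E c N k c₀ μZ =
      (weightedTruncMeasure F E c N k c₁ μZ).restrict {z | c₀ < borelQuotHeight F E c N z} := by
  have hS : ({z | c₀ < borelQuotHeight F E c N z} ∩ {z | c₁ < borelQuotHeight F E c N z} : Set (borelQuotient F E c N)) =
      {z | c₀ < borelQuotHeight F E c N z} :=
    inter_eq_left.2 fun z (hz : c₀ < borelQuotHeight F E c N z) => lt_of_le_of_lt h hz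
  rw [weightedTruncMeasure, weightedTruncMeasure, restrict_withDensity (K2E1TruncatedCuspCompactU2.measurableSet_lt_borelQuotHeight c₀),
    restrict_restrict (K2E1TruncatedCuspCompactU2.measurableSet_lt_borelQuotHeight c₀), hS]

/-- **The height is left-`N(𝔸)B(F)`-invariant**: `H(x g) = H(g)` for `x ∈ N(𝔸)B(F)` (★ `borelHeight_unipotent_mul` and the product-formula lemma ★
`borelHeight_rational_borel_mul`, combined by FILE A's subgroup device). [cite: BernsteinLapid2019, §4 p. 9] [cite: MoeglinWaldspurger1995, I.2.6] -/
theorem borelHeight_adelicUnipBorel_mul :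
    ∀ x ∈ adelicUnipBorelSubgroup F E c N, ∀ g : (quasiSplit F E c N).Adelic, borelHeight (x * g) = borelHeight g :=
  forall_mem_adelicUnipBorelSubgroup_mul_eq (Ψ := fun g : (quasiSplit F E c N).Adelic => borelHeight g)
    (fun u g => borelHeight_unipotent_mul u.2 g)
    (fun b hb g => by
      obtain ⟨γ, hγ, hγB⟩ := exists_eq_toAdelic_of_mem_ratBorelSubgroup F E c N hb
      rw [← hγ]
      exact borelHeight_rational_borel_mul γ hγB g)

/-- **`HZ` is `mN`-measurable**: being left-`N(𝔸)B(F)`-invariant and continuous, the height descends continuously to the base `N(𝔸)B(F)∖G(𝔸)`, so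
`HZ = H̃ ∘ qN` is measurable for `mN = comap qN (borel)` (the weight `HZ^{−2k}` and the truncations are «functions of the constant-term coordinates»).
[cite: BernsteinLapid2019, §4 Claim 4 p. 10] -/
theorem measurable_invariantSigma_borelQuotHeight : Measurable[invariantSigma F E c N] (borelQuotHeight F E c N) := by
  have hH := borelHeight_adelicUnipBorel_mul (F := F) (E := E) (c := c) (N := N)
  let Hb : adelicBorelQuotient F E c N → ℝ≥0 :=
    Quotient.lift (fun g : (quasiSplit F E c N).Adelic => borelHeight g)
      fun a b (hab : MulAction.orbitRel (adelicUnipBorelSubgroup F E c N) _ a b) => by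
        obtain ⟨x, hx⟩ := hab
        have hx' : (x : (quasiSplit F E c N).Adelic) * b = a := hx
        rw [← hx']
        exact hH _ x.2 b
  have hcont : Continuous Hb := (continuous_borelHeight (F := F) (E := E) (c := c) (N := N)).quotient_lift _
  have heq : borelQuotHeight F E c N = Hb ∘ qN F E c N := by
    funext z
    obtain ⟨g, rfl⟩ := Quotient.exists_rep
      (z : Quotient (MulAction.orbitRel (ratBorelSubgroup F E c N) (quasiSplit F E c N).Adelic))
    rfl
  letI mB : MeasurableSpace (adelicBorelQuotient F E c N) := borel _
  haveI : BorelSpace (adelicBorelQuotient F E c N) := ⟨rfl⟩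
  rw [heq]
  exact hcont.measurable.comp (measurable_iff_comap_le.2 le_rfl)

/-- **The truncation sets are `mN`-sets**: `{c₀ < HZ} ∈ mN`. [cite: BernsteinLapid2019, §4 Claim 4 p. 10] -/
theorem measurableSet_invariantSigma_setOf_lt (c₀ : ℝ≥0) :
    MeasurableSet[invariantSigma F E c N] {z : borelQuotient F E c N | c₀ < borelQuotHeight F E c N z} :=
  measurable_invariantSigma_borelQuotHeight measurableSet_Ioi

/-! ## §2 The constant-term projection as a conditional expectation, at two levels -/

section TwoLevels

variable (k : ℕ) {c₁ c₀ : ℝ≥0} (μZ : Measure (borelQuotient F E c N))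

/-- **Generic unfolding of `cnst_k` on ANY class**: `⇑(cnst_k f) = μw[⇑f | mN]` a.e. (Mathlib `MemLp.condExpL2_ae_eq_condExp` at `f = toLp ⇑f`), for
`μw = weightedTruncMeasure k c μZ` finite. [cite: BernsteinLapid2019, §4 Claim 4 p. 10] [cite: MoeglinWaldspurger1995, I.2.6] -/
theorem coeFn_cnstN_ae_eq_condExp (c₁ : ℝ≥0) [IsFiniteMeasure (weightedTruncMeasure F E c N k c₁ μZ)] (f : HN F E c N k c₁ μZ) :
    ((cnstN F E c N k c₁ μZ f : HN F E c N k c₁ μZ) : borelQuotient F E c N → ℂ)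
      =ᵐ[weightedTruncMeasure F E c N k c₁ μZ]
        (weightedTruncMeasure F E c N k c₁ μZ)[(f : borelQuotient F E c N → ℂ) | invariantSigma F E c N] := by
  have h := (Lp.memLp f).condExpL2_ae_eq_condExp (E := ℂ) (𝕜 := ℂ) (invariantSigma_le F E c N)
  rw [Lp.toLp_coeFn f (Lp.memLp f)] at h
  exact h

/-- **Conditioning on `mN` commutes with raising the truncation level**: `μw_{c₀}[f | mN] = μw_c[f | mN]` a.e. on `Z_{c₀}` (`c ≤ c₀`), since
`μw_{c₀} = μw_c|_{Z_{c₀}}` and `Z_{c₀}` is an `mN`-set (Mathlib `condExp_restrict_ae_eq_restrict`). [cite: BernsteinLapid2019, §4 Claim 4 p. 10] -/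
theorem condExp_weightedTruncMeasure_ae_eq_condExp (h : c₁ ≤ c₀) [IsFiniteMeasure (weightedTruncMeasure F E c N k c₁ μZ)]
    {f : borelQuotient F E c N → ℂ} (hf : Integrable f (weightedTruncMeasure F E c N k c₁ μZ)) :
    (weightedTruncMeasure F E c N k c₀ μZ)[f | invariantSigma F E c N]
      =ᵐ[weightedTruncMeasure F E c N k c₀ μZ] (weightedTruncMeasure F E c N k c₁ μZ)[f | invariantSigma F E c N] := by
  rw [weightedTruncMeasure_eq_restrict k h μZ]
  exact condExp_restrict_ae_eq_restrict (invariantSigma_le F E c N) (measurableSet_invariantSigma_setOf_lt c₀) hf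

/-! ## §3 `cnst_k ∘ restr_{c,c₀} = restr_{c,c₀} ∘ cnst_k` and its corollaries -/

/-- **THE COMMUTATION, pointwise form**: `cnst_k (restr_{c,c₀} f) = restr_{c,c₀} (cnst_k f)` for every `f ∈ 𝓗_k(Z_c)`, `c ≤ c₀` — both sides are a.e.
equal to `μw_c[⇑f | mN]` on `Z_{c₀}` [BernsteinLapid2019, §4 Claim 4: «cnst_N … compatible with the restriction maps»]. Hypothesis: `μw_c` finite
(K2E1-p08's `isFiniteMeasure_weightedTruncMeasure_cm`; `μw_{c₀} ≤ μw_c` is then finite too). [cite: BernsteinLapid2019, §4 Claim 4 p. 10]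
[cite: MoeglinWaldspurger1995, I.2.6] -/
theorem cnstN_restrHN (h : c₁ ≤ c₀) [IsFiniteMeasure (weightedTruncMeasure F E c N k c₁ μZ)] (f : HN F E c N k c₁ μZ) :
    cnstN F E c N k c₀ μZ (restrHN F E c N k h μZ f) = restrHN F E c N k h μZ (cnstN F E c N k c₁ μZ f) := by
  haveI : IsFiniteMeasure (weightedTruncMeasure F E c N k c₀ μZ) :=
    isFiniteMeasure_of_le _ (weightedTruncMeasure_mono F E c N k h μZ)
  refine Lp.ext ?_
  have h1 := coeFn_cnstN_ae_eq_condExp k μZ c₀ (restrHN F E c N k h μZ f)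
  have h2 : (weightedTruncMeasure F E c N k c₀ μZ)[(restrHN F E c N k h μZ f : borelQuotient F E c N → ℂ) | invariantSigma F E c N]
      =ᵐ[weightedTruncMeasure F E c N k c₀ μZ]
        (weightedTruncMeasure F E c N k c₀ μZ)[(f : borelQuotient F E c N → ℂ) | invariantSigma F E c N] :=
    condExp_congr_ae (coeFn_restrHN h f)
  have h3 := condExp_weightedTruncMeasure_ae_eq_condExp k μZ h ((Lp.memLp f).integrable one_le_two)
  have h4 : (weightedTruncMeasure F E c N k c₁ μZ)[(f : borelQuotient F E c N → ℂ) | invariantSigma F E c N]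
      =ᵐ[weightedTruncMeasure F E c N k c₀ μZ] ((cnstN F E c N k c₁ μZ f : HN F E c N k c₁ μZ) : borelQuotient F E c N → ℂ) :=
    (weightedTruncMeasure_absolutelyContinuous F E c N k h μZ).ae_le (coeFn_cnstN_ae_eq_condExp k μZ c₁ f).symm
  have h5 := (coeFn_restrHN h (cnstN F E c N k c₁ μZ f)).symm
  exact h1.trans (h2.trans (h3.trans (h4.trans h5)))

/-- **THE COMMUTATION, operator form**: `cnst_k ∘L restr_{c,c₀} = restr_{c,c₀} ∘L cnst_k` (`c ≤ c₀`, `μw_c` finite). [cite: BernsteinLapid2019, §4 Claim 4 p. 10] -/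
theorem cnstN_comp_restrHN (h : c₁ ≤ c₀) [IsFiniteMeasure (weightedTruncMeasure F E c N k c₁ μZ)] :
    cnstN F E c N k c₀ μZ ∘L restrHN F E c N k h μZ = restrHN F E c N k h μZ ∘L cnstN F E c N k c₁ μZ :=
  ContinuousLinearMap.ext fun f => cnstN_restrHN k μZ h f

/-- Classes fixed by `cnst_k` (the `N(𝔸)`-invariant classes, «functions of the constant-term coordinates») restrict to classes fixed by `cnst_k`.
[cite: BernsteinLapid2019, §4 Claim 4 p. 10] -/
theorem cnstN_restrHN_of_cnstN_eq_self (h : c₁ ≤ c₀) [IsFiniteMeasure (weightedTruncMeasure F E c N k c₁ μZ)] {f : HN F E c N k c₁ μZ}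
    (hf : cnstN F E c N k c₁ μZ f = f) :
    cnstN F E c N k c₀ μZ (restrHN F E c N k h μZ f) = restrHN F E c N k h μZ f := by
  rw [cnstN_restrHN k μZ h f, hf]

/-- The restriction maps `mN`-measurable classes (`lpMeas`, the range of `cnst_k`) to `mN`-measurable classes. [cite: BernsteinLapid2019, §4 Claim 4 p. 10] -/
theorem restrHN_mem_lpMeas (h : c₁ ≤ c₀) [IsFiniteMeasure (weightedTruncMeasure F E c N k c₁ μZ)] {f : HN F E c N k c₁ μZ}
    (hf : f ∈ lpMeas ℂ ℂ (invariantSigma F E c N) 2 (weightedTruncMeasure F E c N k c₁ μZ)) :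
    restrHN F E c N k h μZ f ∈ lpMeas ℂ ℂ (invariantSigma F E c N) 2 (weightedTruncMeasure F E c N k c₀ μZ) := by
  rw [← cnstN_restrHN_of_cnstN_eq_self k μZ h (cnstN_eq_self_of_mem_lpMeas hf)]
  exact cnstN_mem_lpMeas F E c N k c₀ μZ _

/-- **Cusp classes restrict to cusp classes**: `f ∈ 𝓗_k(Z_c)^cusp ⟹ restr_{c,c₀} f ∈ 𝓗_k(Z_{c₀})^cusp`. [cite: BernsteinLapid2019, §4 Claim 5 p. 10] -/
theorem restrHN_mem_HNcusp (h : c₁ ≤ c₀) [IsFiniteMeasure (weightedTruncMeasure F E c N k c₁ μZ)] {f : HN F E c N k c₁ μZ}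
    (hf : f ∈ HNcusp F E c N k c₁ μZ) : restrHN F E c N k h μZ f ∈ HNcusp F E c N k c₀ μZ := by
  rw [mem_HNcusp_iff] at hf ⊢
  rw [cnstN_restrHN k μZ h f, hf, map_zero]

/-- Submodule form: `restr_{c,c₀}(𝓗_k(Z_c)^cusp) ≤ 𝓗_k(Z_{c₀})^cusp`. [cite: BernsteinLapid2019, §4 Claim 5 p. 10] -/
theorem map_restrHN_HNcusp_le (h : c₁ ≤ c₀) [IsFiniteMeasure (weightedTruncMeasure F E c N k c₁ μZ)] :
    (HNcusp F E c N k c₁ μZ).map (restrHN F E c N k h μZ).toLinearMap ≤ HNcusp F E c N k c₀ μZ := by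
  rintro _ ⟨f, hf, rfl⟩
  exact restrHN_mem_HNcusp k μZ h hf

/-- The decomposition `f = (f − cnst f) + cnst f` is respected by restriction: `restr (f − cnst_k f) = restr f − cnst_k (restr f)` lies in the cusp part
of the higher level. [cite: BernsteinLapid2019, §4 Claim 5 p. 10] -/
theorem restrHN_sub_cnstN (h : c₁ ≤ c₀) [IsFiniteMeasure (weightedTruncMeasure F E c N k c₁ μZ)] (f : HN F E c N k c₁ μZ) :
    restrHN F E c N k h μZ (f - cnstN F E c N k c₁ μZ f) =
      restrHN F E c N k h μZ f - cnstN F E c N k c₀ μZ (restrHN F E c N k h μZ f) := by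
  rw [map_sub, cnstN_restrHN k μZ h f]

end TwoLevels

end Summit.HodgeConjecture.HodgeConjecture.Cruxes.H413.K2E1BLConstantTermProjectionRestrictU2

end
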